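import Mathlib.MeasureTheory.Measure.Prod
import Literature.Probability.RandomPlanarGeometry.LoopSpaceUniform
import HarnessLib

/-!
# Two-threshold trace events in loop space, with parameters, and an averaging lemma

Topic: Probability / random planar geometry. General glue for Möbius-averaging arguments on laws of
loop collections (used for the no-touching property of the Camia–Newman scaling limit of critical
percolation, `Literature.Probability.Percolation.TwoArmNoTouchingMoebius`). For a function
`F : P → E → ℝ` jointly continuous in a parameter `θ ∈ P` and the point, the *two-threshold event*

  `{(θ, L) | ∃ c ∈ L, (∃ z ∈ range c, F θ z < a) ∧ (∃ z ∈ range c, b < F θ z)}`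

("some member of the collection `L` reaches strictly below level `a` and strictly above level `b`
for the function `F θ`") is open in `P × LoopSpace E` (`isOpen_setOf_exists_mem_range`); hence the
parametrised *near-miss events* — every slight enlargement `(a + 1/(n+1), b - 1/(n+1))` is reached
but `(a, b)` itself is not reached strictly — are Borel in the product
(`measurableSet_nearMiss_prod`; only the parameter space needs to be second countable, loop space
is not). Push-forwards: a two-threshold event for `f` read on `LoopSpace.map Φ L` forces the event
for `f ∘ Φ` on `L` and conversely (`exists_mem_range_comp_of_map`, `exists_mem_map_of_comp`), so
the preimage of a near-miss event under `LoopSpace.map Φ` lies in the near-miss event of `f ∘ Φ`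
(`map_preimage_nearMiss_subset`). Finally the abstract **averaging lemma**
`measure_eq_zero_of_ae_le_sections`: if `ν B ≤ ν S_θ` for `μ`-almost every parameter `θ` of a
measurable `S ⊆ P × X`, `μ ≠ 0`, and `ν`-almost every `x` has a `μ`-null set of parameters `θ` with
`(θ, x) ∈ S`, then `ν B = 0` (Tonelli).

Everything is proved; no definitions and no named facts are introduced.

## References

* F. Camia, C. M. Newman, Comm. Math. Phys. 268 (2006), §2 (the space of loop collections).
* M. Aizenman, A. Burchard, Duke Math. J. 99 (1999), §2.1 (curves modulo reparametrisation).
-/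

noncomputable section

open Set Filter Topology Metric MeasureTheory
open scoped ENNReal

namespace Literature.Probability.RandomPlanarGeometry

namespace LoopSpace

variable {E : Type*} [MetricSpace E]

/-! ### Traces of nearby curve classes -/

/-- A point of the trace of a curve class has a point of the trace of any `ε`-close class within
distance `ε` (Aizenman–Burchard 1999, §2.1). [folklore] -/
theorem exists_mem_range_dist_lt {c c' : CurveClass E} {ε : ℝ} (h : dist c c' < ε) {z : E}
    (hz : z ∈ c.range) : ∃ z' ∈ c'.range, dist z z' < ε := by
  obtain ⟨γ, rfl⟩ := CurveClass.surjective_mk c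
  obtain ⟨γ', rfl⟩ := CurveClass.surjective_mk c'
  rw [CurveClass.dist_mk_mk] at h
  rw [CurveClass.range_mk] at hz
  obtain ⟨t, rfl⟩ := Curve.mem_range.1 hz
  have := (Curve.infDist_range_le γ γ' t).trans_lt h
  obtain ⟨z', hz', hd⟩ := (Metric.infDist_lt_iff (Curve.range_nonempty γ')).1 this
  exact ⟨z', by rwa [CurveClass.range_mk], hd⟩

/-- A member of a collection has an `ε`-close member in every collection at Hausdorff edistance
`< ε`. [folklore] -/
theorem exists_mem_dist_lt {L L' : LoopSpace E} {ε : ℝ} (h : edist L L' < ENNReal.ofReal ε)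
    {c : CurveClass E} (hc : c ∈ L) : ∃ c' ∈ L', dist c c' < ε := by
  rw [TopologicalSpace.Closeds.edist_eq] at h
  obtain ⟨c', hc', hlt⟩ := exists_edist_lt_of_hausdorffEDist_lt hc h
  exact ⟨c', hc', edist_lt_ofReal.1 hlt⟩

/-! ### Two-threshold trace events are open, jointly in a parameter -/

/-- **Two-threshold trace events are open in parameter × loop space.** If `F : P → E → ℝ` is
jointly continuous, the set of pairs `(θ, L)` such that some member of `L` has a trace point with
`F θ < a` and a trace point with `b < F θ` is open in `P × LoopSpace E`: the two witnessing points
survive a small change of `θ` (joint continuity) and of `L` (a Hausdorff-close collection has a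
member whose trace passes near both points). [folklore] -/
theorem isOpen_setOf_exists_mem_range {P : Type*} [TopologicalSpace P] {F : P → E → ℝ}
    (hF : Continuous (Function.uncurry F)) (a b : ℝ) :
    IsOpen {x : P × LoopSpace E | ∃ c ∈ x.2, (∃ z ∈ CurveClass.range c, F x.1 z < a) ∧
      ∃ z ∈ CurveClass.range c, b < F x.1 z} := by
  rw [isOpen_iff_mem_nhds]
  rintro ⟨θ, L⟩ ⟨c, hc, ⟨z₁, hz₁, h₁⟩, z₂, hz₂, h₂⟩
  -- neighbourhoods from joint continuity at `(θ, z₁)` and `(θ, z₂)`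
  have hn₁ : {p : P × E | F p.1 p.2 < a} ∈ 𝓝 (θ, z₁) :=
    hF.continuousAt.preimage_mem_nhds (Iio_mem_nhds h₁)
  have hn₂ : {p : P × E | b < F p.1 p.2} ∈ 𝓝 (θ, z₂) :=
    hF.continuousAt.preimage_mem_nhds (Ioi_mem_nhds h₂)
  obtain ⟨U₁, hU₁, V₁, hV₁, hUV₁⟩ := mem_nhds_prod_iff.1 hn₁
  obtain ⟨U₂, hU₂, V₂, hV₂, hUV₂⟩ := mem_nhds_prod_iff.1 hn₂
  obtain ⟨ε₁, hε₁, hb₁⟩ := Metric.mem_nhds_iff.1 hV₁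
  obtain ⟨ε₂, hε₂, hb₂⟩ := Metric.mem_nhds_iff.1 hV₂
  set ε := min ε₁ ε₂ with hε
  have hεpos : 0 < ε := lt_min hε₁ hε₂
  have hW : (U₁ ∩ U₂) ×ˢ Metric.eball L (ENNReal.ofReal ε) ∈ 𝓝 (θ, L) :=
    prod_mem_nhds (inter_mem hU₁ hU₂) (Metric.eball_mem_nhds L (by simpa using hεpos))
  refine Filter.mem_of_superset hW ?_
  rintro ⟨θ', L'⟩ ⟨⟨hθ₁, hθ₂⟩, hL'⟩
  replace hL' : edist L L' < ENNReal.ofReal ε := by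
    have : L' ∈ Metric.eball L (ENNReal.ofReal ε) := hL'
    rw [Metric.mem_eball, edist_comm] at this
    exact this
  obtain ⟨c', hc', hcc'⟩ := exists_mem_dist_lt hL' hc
  obtain ⟨w₁, hw₁, hd₁⟩ := exists_mem_range_dist_lt hcc' hz₁
  obtain ⟨w₂, hw₂, hd₂⟩ := exists_mem_range_dist_lt hcc' hz₂
  refine ⟨c', hc', ⟨w₁, hw₁, ?_⟩, w₂, hw₂, ?_⟩
  · have : (θ', w₁) ∈ U₁ ×ˢ V₁ :=
      ⟨hθ₁, hb₁ (mem_ball.2 (by rw [dist_comm]; exact hd₁.trans_le (min_le_left _ _)))⟩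
    exact hUV₁ this
  · have : (θ', w₂) ∈ U₂ ×ˢ V₂ :=
      ⟨hθ₂, hb₂ (mem_ball.2 (by rw [dist_comm]; exact hd₂.trans_le (min_le_right _ _)))⟩
    exact hUV₂ this

/-- **Two-threshold trace events are open in loop space** (the parameter-free case): for a
continuous `f : E → ℝ`, the collections some member of which has trace points with `f < a` and with
`b < f` form an open set. [folklore] -/
theorem isOpen_setOf_exists_mem_range' {f : E → ℝ} (hf : Continuous f) (a b : ℝ) :
    IsOpen {L : LoopSpace E | ∃ c ∈ L, (∃ z ∈ CurveClass.range c, f z < a) ∧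
      ∃ z ∈ CurveClass.range c, b < f z} := by
  have h := isOpen_setOf_exists_mem_range (P := Unit) (F := fun _ z ↦ f z)
    (hf.comp continuous_snd) a b
  exact h.preimage (Continuous.prodMk_right ())

/-! ### Near-miss events are Borel -/

/-- **Parametrised near-miss events are Borel in parameter × loop space.** For `F : P → E → ℝ`
jointly continuous with `P` second countable, the set of `(θ, L)` such that for every `n` some
member of `L` reaches `F θ < a + 1/(n+1)` and `F θ > b - 1/(n+1)`, but no member reaches `F θ < a`
and `F θ > b`, is measurable (a `G_δ` minus an open set; the product of the Borel σ-algebras is the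
Borel σ-algebra of the product because the parameter space is second countable). [folklore] -/
theorem measurableSet_nearMiss_prod {P : Type*} [TopologicalSpace P] [MeasurableSpace P] [OpensMeasurableSpace P]
    [SecondCountableTopology P] {F : P → E → ℝ} (hF : Continuous (Function.uncurry F)) (a b : ℝ) :
    MeasurableSet {x : P × LoopSpace E |
      (∀ n : ℕ, ∃ c ∈ x.2, (∃ z ∈ CurveClass.range c, F x.1 z < a + ((n : ℝ) + 1)⁻¹) ∧
        ∃ z ∈ CurveClass.range c, b - ((n : ℝ) + 1)⁻¹ < F x.1 z) ∧
      ¬ ∃ c ∈ x.2, (∃ z ∈ CurveClass.range c, F x.1 z < a) ∧ ∃ z ∈ CurveClass.range c, b < F x.1 z} := by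
  have h1 : MeasurableSet (⋂ n : ℕ, {x : P × LoopSpace E | ∃ c ∈ x.2,
      (∃ z ∈ CurveClass.range c, F x.1 z < a + ((n : ℝ) + 1)⁻¹) ∧
        ∃ z ∈ CurveClass.range c, b - ((n : ℝ) + 1)⁻¹ < F x.1 z}) :=
    MeasurableSet.iInter fun n ↦ (isOpen_setOf_exists_mem_range hF _ _).measurableSet
  have h2 : MeasurableSet {x : P × LoopSpace E | ∃ c ∈ x.2,
      (∃ z ∈ CurveClass.range c, F x.1 z < a) ∧ ∃ z ∈ CurveClass.range c, b < F x.1 z} :=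
    (isOpen_setOf_exists_mem_range hF a b).measurableSet
  convert h1.inter h2.compl using 1
  ext x
  simp only [mem_inter_iff, mem_iInter, mem_setOf_eq, mem_compl_iff]

/-- **Near-miss events are Borel in loop space** (parameter-free case). [folklore] -/
theorem measurableSet_nearMiss {f : E → ℝ} (hf : Continuous f) (a b : ℝ) :
    MeasurableSet {L : LoopSpace E |
      (∀ n : ℕ, ∃ c ∈ L, (∃ z ∈ CurveClass.range c, f z < a + ((n : ℝ) + 1)⁻¹) ∧
        ∃ z ∈ CurveClass.range c, b - ((n : ℝ) + 1)⁻¹ < f z) ∧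
      ¬ ∃ c ∈ L, (∃ z ∈ CurveClass.range c, f z < a) ∧ ∃ z ∈ CurveClass.range c, b < f z} := by
  have h1 : MeasurableSet (⋂ n : ℕ, {L : LoopSpace E | ∃ c ∈ L,
      (∃ z ∈ CurveClass.range c, f z < a + ((n : ℝ) + 1)⁻¹) ∧
        ∃ z ∈ CurveClass.range c, b - ((n : ℝ) + 1)⁻¹ < f z}) :=
    MeasurableSet.iInter fun n ↦ (isOpen_setOf_exists_mem_range' hf _ _).measurableSet
  have h2 : MeasurableSet {L : LoopSpace E | ∃ c ∈ L,
      (∃ z ∈ CurveClass.range c, f z < a) ∧ ∃ z ∈ CurveClass.range c, b < f z} :=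
    (isOpen_setOf_exists_mem_range' hf a b).measurableSet
  convert h1.inter h2.compl using 1
  ext L
  simp only [mem_inter_iff, mem_iInter, mem_setOf_eq, mem_compl_iff]

/-- The near-miss event with closed thresholds `≤ a + ε`, `≥ b - ε` for all `ε > 0` is contained in
the Borel near-miss event with the open thresholds `< a + 1/(n+1)`, `> b - 1/(n+1)` for all `n`. [folklore] -/
theorem nearMiss_subset_nearMiss (f : E → ℝ) (a b : ℝ) :
    {L : LoopSpace E |
      (∀ ε > 0, ∃ c ∈ L, (∃ z ∈ CurveClass.range c, f z ≤ a + ε) ∧ ∃ z ∈ CurveClass.range c, b - ε ≤ f z) ∧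
      ¬ ∃ c ∈ L, (∃ z ∈ CurveClass.range c, f z < a) ∧ ∃ z ∈ CurveClass.range c, b < f z} ⊆
    {L : LoopSpace E |
      (∀ n : ℕ, ∃ c ∈ L, (∃ z ∈ CurveClass.range c, f z < a + ((n : ℝ) + 1)⁻¹) ∧
        ∃ z ∈ CurveClass.range c, b - ((n : ℝ) + 1)⁻¹ < f z) ∧
      ¬ ∃ c ∈ L, (∃ z ∈ CurveClass.range c, f z < a) ∧ ∃ z ∈ CurveClass.range c, b < f z} := by
  rintro L ⟨h, h'⟩
  refine ⟨fun n ↦ ?_, h'⟩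
  have hn : (0 : ℝ) < ((n : ℝ) + 1)⁻¹ := by positivity
  obtain ⟨c, hc, ⟨z₁, hz₁, h₁⟩, z₂, hz₂, h₂⟩ := h (((n : ℝ) + 1)⁻¹ / 2) (half_pos hn)
  exact ⟨c, hc, ⟨z₁, hz₁, by linarith⟩, z₂, hz₂, by linarith⟩

/-! ### Two-threshold events under push-forwards -/

variable {E' : Type*} [MetricSpace E']

/-- **A two-threshold event read on a push-forward comes from the original collection.** If some
member of `LoopSpace.map Φ L` (the closure of the image) has trace points with `f < a` and `b < f`
(`f` continuous), then some member of `L` has trace points with `f ∘ Φ < a` and `b < f ∘ Φ`: the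
member is a limit of images of members, and strict inequalities survive. [folklore] -/
theorem exists_mem_range_comp_of_map {Φ : C(E, E')} {f : E' → ℝ} (hf : Continuous f) {a b : ℝ}
    {L : LoopSpace E} (h : ∃ c' ∈ map Φ L, (∃ z ∈ CurveClass.range c', f z < a) ∧
      ∃ z ∈ CurveClass.range c', b < f z) :
    ∃ c ∈ L, (∃ z ∈ CurveClass.range c, f (Φ z) < a) ∧ ∃ z ∈ CurveClass.range c, b < f (Φ z) := by
  obtain ⟨c', hc', ⟨z₁, hz₁, h₁⟩, z₂, hz₂, h₂⟩ := h
  have hc'' : c' ∈ closure (CurveClass.map Φ '' (L : Set (CurveClass E))) := by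
    have := hc'
    rwa [← SetLike.mem_coe, coe_map] at this
  -- slack from the strict inequalities and continuity of `f`
  obtain ⟨ε₁, hε₁, hb₁⟩ := Metric.mem_nhds_iff.1 (hf.continuousAt.preimage_mem_nhds (Iio_mem_nhds h₁))
  obtain ⟨ε₂, hε₂, hb₂⟩ := Metric.mem_nhds_iff.1 (hf.continuousAt.preimage_mem_nhds (Ioi_mem_nhds h₂))
  obtain ⟨d, hd, hdε⟩ := Metric.mem_closure_iff.1 hc'' (min ε₁ ε₂) (lt_min hε₁ hε₂)
  obtain ⟨c, hc, rfl⟩ := hd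
  obtain ⟨w₁, hw₁, hd₁⟩ := exists_mem_range_dist_lt hdε hz₁
  obtain ⟨w₂, hw₂, hd₂⟩ := exists_mem_range_dist_lt hdε hz₂
  rw [CurveClass.range_map] at hw₁ hw₂
  obtain ⟨y₁, hy₁, rfl⟩ := hw₁
  obtain ⟨y₂, hy₂, rfl⟩ := hw₂
  refine ⟨c, hc, ⟨y₁, hy₁, ?_⟩, y₂, hy₂, ?_⟩
  · exact hb₁ (mem_ball.2 (by rw [dist_comm]; exact hd₁.trans_le (min_le_left _ _)))
  · exact hb₂ (mem_ball.2 (by rw [dist_comm]; exact hd₂.trans_le (min_le_right _ _)))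

/-- **A two-threshold event for `f ∘ Φ` passes to the push-forward**: the image of the witnessing
member witnesses the event for `f` on `LoopSpace.map Φ L`. [folklore] -/
theorem exists_mem_map_of_comp (Φ : C(E, E')) (f : E' → ℝ) {a b : ℝ} {L : LoopSpace E}
    (h : ∃ c ∈ L, (∃ z ∈ CurveClass.range c, f (Φ z) < a) ∧ ∃ z ∈ CurveClass.range c, b < f (Φ z)) :
    ∃ c' ∈ map Φ L, (∃ z ∈ CurveClass.range c', f z < a) ∧ ∃ z ∈ CurveClass.range c', b < f z := by
  obtain ⟨c, hc, ⟨z₁, hz₁, h₁⟩, z₂, hz₂, h₂⟩ := h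
  refine ⟨c.map Φ, map_mem_map Φ hc, ⟨Φ z₁, ?_, h₁⟩, Φ z₂, ?_, h₂⟩
  · rw [CurveClass.range_map]; exact mem_image_of_mem _ hz₁
  · rw [CurveClass.range_map]; exact mem_image_of_mem _ hz₂

/-- **The preimage of a near-miss event under a push-forward lies in the near-miss event of the
composed function.** [folklore] -/
theorem map_preimage_nearMiss_subset (Φ : C(E, E')) {f : E' → ℝ} (hf : Continuous f) (a b : ℝ) :
    map Φ ⁻¹' {L' : LoopSpace E' |
      (∀ n : ℕ, ∃ c ∈ L', (∃ z ∈ CurveClass.range c, f z < a + ((n : ℝ) + 1)⁻¹) ∧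
        ∃ z ∈ CurveClass.range c, b - ((n : ℝ) + 1)⁻¹ < f z) ∧
      ¬ ∃ c ∈ L', (∃ z ∈ CurveClass.range c, f z < a) ∧ ∃ z ∈ CurveClass.range c, b < f z} ⊆
    {L : LoopSpace E |
      (∀ n : ℕ, ∃ c ∈ L, (∃ z ∈ CurveClass.range c, f (Φ z) < a + ((n : ℝ) + 1)⁻¹) ∧
        ∃ z ∈ CurveClass.range c, b - ((n : ℝ) + 1)⁻¹ < f (Φ z)) ∧
      ¬ ∃ c ∈ L, (∃ z ∈ CurveClass.range c, f (Φ z) < a) ∧ ∃ z ∈ CurveClass.range c, b < f (Φ z)} := by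
  rintro L ⟨h, h'⟩
  exact ⟨fun n ↦ exists_mem_range_comp_of_map hf (h n), fun hh ↦ h' (exists_mem_map_of_comp Φ f hh)⟩

end LoopSpace

/-! ### The averaging lemma -/

/-- **Averaging lemma** (Tonelli). Let `S ⊆ P × X` be measurable, `μ` an s-finite non-zero measure
on the parameter space `P` and `ν` an s-finite measure on `X`. If `ν B ≤ ν {x | (θ, x) ∈ S}` for
`μ`-a.e. `θ`, while for `ν`-a.e. `x` the set of parameters `{θ | (θ, x) ∈ S}` is `μ`-null, then
`ν B = 0`: by Tonelli `(μ × ν) S = ∫ μ {θ | (θ, x) ∈ S} dν = 0`, so `ν`-sections are null for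
`μ`-a.e. `θ`, and some `θ` enjoys both properties. This is the form in which the invariance of a
law under a family of transformations is averaged over the family. [folklore] -/
theorem measure_eq_zero_of_ae_le_sections {P X : Type*} [MeasurableSpace P] [MeasurableSpace X]
    {μ : Measure P} [SFinite μ] {ν : Measure X} [SFinite ν] (hμ : μ ≠ 0) {S : Set (P × X)}
    (hS : MeasurableSet S) {B : Set X} (hB : ∀ᵐ θ ∂μ, ν B ≤ ν (Prod.mk θ ⁻¹' S))
    (hsec : ∀ᵐ x ∂ν, μ ((fun θ ↦ (θ, x)) ⁻¹' S) = 0) : ν B = 0 := by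
  have hprod : μ.prod ν S = 0 := by
    rw [Measure.prod_apply_symm hS, lintegral_congr_ae hsec, lintegral_zero]
  rw [Measure.prod_apply hS, lintegral_eq_zero_iff (measurable_measure_prodMk_left hS)] at hprod
  haveI : (ae μ).NeBot := ae_neBot.2 hμ
  obtain ⟨θ, hθB, hθ0⟩ := (hB.and hprod).exists
  exact nonpos_iff_eq_zero.1 (hθB.trans (le_of_eq hθ0))

end Literature.Probability.RandomPlanarGeometry
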